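import Summits.HodgeConjecture.HodgeConjecture.Theorems.HeckePrymWeilHeckePrymAnchorsOfKAction
import Literature.AlgebraicGeometry.HodgeTheory.WeilFamilyLevelStructure
import HarnessLib

/-!
# `HeckePrymAnchors` modulo ONE named fact: Deligne's abelian scheme with `𝒪_K`-action and level-`n` structure (item stmt-HodgeConjecture-14496, route HeckePrymWeil)

Line `Sketch`, v16 (continuation lead c9): the crux `HeckePrymAnchors` of route `HeckePrymWeil`
derived from the single named fact registered as the stub of the line's skeleton
(`Cruxes/HeckePrymAnchors/Lines/Sketch.lean`: `stub_weilFamilyLevelStructure`):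

* `HodgeTheory.deligne1982_weilFamily_levelStructure` (`HodgeTheory/WeilFamilyLevelStructure`;
  [Deligne1982HodgeCycles], proof of Thm. 4.8: the abelian scheme with `𝒪_K`-action over the
  level-`n` moduli variety `Γ\X⁺` through `X`, fibrewise charts by abelian `2k`-folds with `√-p`,
  an integral level-`n` structure (`n ≥ 3`) on the monodromy at `s₁`, and a CM/tensor fibre — clause
  (a) and the flatness of the Weil class being the tree's THEOREMS
  `deligne1982_weilFamily_globalAction_of_kAction` (`WeilFamilyKAction`) and
  `deligne1982_weilFamily_kAction_of_levelStructure` (`WeilFamilyLevelStructure`, via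
  `WeilLineDetOfLevelStructure`: an `𝒪_K`-linear lattice automorphism `≡ 1 (mod n)`, `n ≥ 3`, has
  `det_K = 1`).

The proof is the composition of `deligne1982_weilFamily_kAction_of_levelStructure` with the landed
one-fact closure `heckePrymAnchors_of_kAction` (p121707). No `sorry`, no definition, no new axiom.
-/

noncomputable section

-- every declaration of this problem lives in `Summit.HodgeConjecture.HodgeConjecture.…` (summit = sub-problem)
set_option linter.dupNamespace false

open CategoryTheory AlgebraicGeometry Limits MonoidalCategory CartesianMonoidalCategory

namespace Summit.HodgeConjecture.HodgeConjecture.Theorems.HeckePrymWeilLine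

open Literature.AlgebraicGeometry Literature.AlgebraicGeometry.Motives Literature.AlgebraicGeometry.HodgeTheory
open Summit.HodgeConjecture.HodgeConjecture.Theses.HeckePrymWeil

/-- **`HeckePrymAnchors` from Deligne's abelian scheme with `𝒪_K`-action and level-`n`
structure.** The crux of route `HeckePrymWeil` follows from the one named fact
`HodgeTheory.deligne1982_weilFamily_levelStructure`: the flat Weil section is the tree's theorem
`deligne1982_weilFamily_kAction_of_levelStructure` (level-`n` ⇒ `det_K = 1` on the Weil lines),
and the landed one-fact closure `heckePrymAnchors_of_kAction` concludes.
[cite: Deligne1982HodgeCycles, proof of Thm. 4.8 (the group Γ, n ≥ 3) with Thm. 2.15 and Prop. 4.4] -/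
theorem heckePrymAnchors_of_levelStructure :
    (deligne1982_weilFamily_levelStructure) → Summit.HodgeConjecture.HodgeConjecture.Theses.HeckePrymWeil.HeckePrymAnchors :=
  fun hLS => heckePrymAnchors_of_kAction (deligne1982_weilFamily_kAction_of_levelStructure hLS)

end Summit.HodgeConjecture.HodgeConjecture.Theorems.HeckePrymWeilLine

end
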